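import Summits.QuantumFields.BalabanUV.Beta.EriceFlowEnclosureB12AsPrintedHistoryContagionShiftFlowZeroPrincipal
import Summits.QuantumFields.BalabanUV.Beta.EriceFlowEnclosureB12AsPrintedHistoryContagionShiftFlowZeroSemigroup

/-!
# Beta / EriceFlowEnclosureB12AsPrintedHistoryContagionShiftFlowZeroSemigroupCanonical — ASYMPTOTIC FREEDOM IS CONTAGIOUS, part 47: THE CONTINUOUS RENORMALIZATION GROUP IS
# CANONICAL, EQUIVARIANT, AND TRANSLATES THE CHART BY `sβ₀ + O(g)`.  Part 46 built the one-parameter semigroup `φ_s = Λ⁻¹∘(Λ + sβ₀)` on ]0, e′] from an Abel function Λ.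
# §73: (i) the construction sees Λ only up to an additive constant (`rg_eq_of_sub_eq`), hence — by part 44 (`dynAbel_sub_dynAbel`) and part 45 (`abel_levy_eq_dynAbel`) —
# **EVERY dynamical Abel function (any reference pin, one loop or two loops) and EVERY Abel function with Lévy's criterion generate THE SAME semigroup**
# (`rg_eq_of_dynAbel`, **`rg_eq_of_levy`**): THE continuous renormalization group of the flow near zero pin is CANONICAL, i.e. determined by the trajectories and
# first-order agreement with the chart; (ii) it is EQUIVARIANT: the trajectory from the time-s image of a pin is the time-s image of the trajectory,
# **`solution B (φ_s e) k = φ_s (h k)`** (`rg_solution_eq`) — the semigroup permutes the AF trajectories, commuting with the renormalization step; (iii) it acts on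
# the chart by translation up to a relative error O(g): **`|1∕φ_s(g)² − 1∕g² − sβ₀| ≤ κ·g·(1∕φ_s(g)² − 1∕g²)`**, `κ = 64C_m∕(3(1−θ)β*)` (`abs_rg_chart_sub_le`, from part 44's
# isometry), so `sβ₀∕(1 + κg) ≤ 1∕φ_s(g)² − 1∕g² ≤ sβ₀∕(1 − κg)` (`rg_chart_twoSided`): the continuous β-function of the flow with memory is, in the chart and in
# integrated form, `β₀ + O(g)` at every real scale — the continuous counterpart of part 33's `|β_eff(g) − β₀| ≤ 2C_m g∕(1−θ)` for the discrete step.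
# Abstract in B (β-flow team, prover 1, unit `b2b-balaban-beta-bflow-p1`, gen 40; ROW AP-I·Uc × NODE U2 × ROW Λ — canonicity of the continuous RG)

HONEST FRAMING (page 1 of everything the β sub-cell writes): discharging `BetaPertH` makes Bałaban's UV stability UNCONDITIONAL — a
real constructive-QFT result; it is NOT the continuum limit and NOT the Clay problem.  HONEST DEPENDENCY (cell reorg 2026-08-19,
verbatim): «continuum YM on T⁴ ⇐ BetaPertH ∧ nine spine estimates (0/9 proved); BetaPertH ⇐ (D1) ∧ (D4) ∧ CAP+tail; G-an2-4 gates
asym, D1 and NE2/3/4.»  THIS MODULE DISCHARGES NOTHING: elementary order theory and real analysis over node U2's HYPOTHESIS SHAPES `T4BetaStationary.{SeqBox,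
MemoryProfile}`, `T4BetaFlowWellPosed.{MemFlow, solution}` on an ABSTRACT functional `B`; part 46's `rg_mem_eq ∕ rg_add ∕ rg_natCast_eq`, part 45's `abel_levy_eq_dynAbel`,
part 44's `dynAbel_sub_dynAbel ∕ dynAbel_shift ∕ abs_dynAbel_sub_sub_chart_le`, part 34's `package_of_le ∕ succ_le_of_reference_flow`, part 13's `memFlow_solution_of_reference`
BY NAME — nothing restated.  PRECEDENT (classical, cited not imported): principal vs. non-principal iteration groups — G. Szekeres, Acta Math. 100 (1958); M. C. Zdun, ESAIM
Proc. 46 (2014) §1.  `ScaleShiftRate` (GAPS G-t4-U2-1), `HistLipschitz`∕`FadingMemory` (G-t4-U2-2), [I] THEOREM 2 (p. 259, STATED WITHOUT PROOF) do not occur in this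
abstract part (carrier END: part 50); NOTHING is asserted about Bałaban's actual β.  [I] = T. Bałaban, Commun. Math. Phys. **109** (1987) 249–301 [Balaban1987RG1].

WHAT THIS FILE PROVES (0 sorry, 0 def): §73 **`rg_eq_of_sub_eq`**, **`rg_eq_of_dynAbel`**, **`rg_eq_of_levy`**, **`rg_solution_eq`**, **`abs_rg_chart_sub_le`**, `rg_chart_twoSided`.
NOT CLAIMED: canonicity among NON-isometric Abel functions (false: part 48); differentiability in s or an infinitesimal generator; anything about Bałaban's β; `BetaPertH`;
continuum; Clay.
-/

namespace Summit.QuantumFields.BalabanUV.Beta.EriceFlowEnclosureB12AsPrintedHistoryContagionShiftFlowZeroSemigroupCanonical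

open Filter Topology Set Function
open Literature.MathematicalPhysics.QuantumFieldTheory.Balaban1983to89
open Literature.MathematicalPhysics.QuantumFieldTheory.Balaban1983to89.T4BetaStationary (SeqBox MemoryProfile)
open Literature.MathematicalPhysics.QuantumFieldTheory.Balaban1983to89.T4BetaFlowWellPosed (MemFlow solution)
open Summit.QuantumFields.BalabanUV.Beta.EriceFlowEnclosureB12AsPrintedHistoryContagionShiftFlowPicardLimit (memFlow_solution_of_reference)
open Summit.QuantumFields.BalabanUV.Beta.EriceFlowEnclosureB12AsPrintedHistoryContagionShiftFlowZeroOffset (package_of_le succ_le_of_reference_flow)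
open Summit.QuantumFields.BalabanUV.Beta.EriceFlowEnclosureB12AsPrintedHistoryContagionShiftFlowZeroIsometry (dynAbel_shift dynAbel_sub_dynAbel
  abs_dynAbel_sub_sub_chart_le)
open Summit.QuantumFields.BalabanUV.Beta.EriceFlowEnclosureB12AsPrintedHistoryContagionShiftFlowZeroPrincipal (abel_levy_eq_dynAbel)
open Summit.QuantumFields.BalabanUV.Beta.EriceFlowEnclosureB12AsPrintedHistoryContagionShiftFlowZeroSemigroup (rg_mem_eq rg_add rg_natCast_eq)

noncomputable section

/-! ## §73 Canonicity, equivariance, and the chart translation of the continuous renormalization group -/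

/-- **THE SEMIGROUP SEES THE ABEL FUNCTION ONLY UP TO A CONSTANT**: Λ strictly antitone on ]0, e′] and onto `[Λ e′, ∞[`, Λ̃ with `Λ̃ x − Λ x = Λ̃ e′ − Λ e′` on ]0, e′];
then for `g ∈ ]0, e′]`, `s ≥ 0` (β₀ ≥ 0): `invFunOn Λ̃ (Ioc 0 e′) (Λ̃ g + sβ₀) = invFunOn Λ (Ioc 0 e′) (Λ g + sβ₀)` — the same time-s map. [folklore] -/
theorem rg_eq_of_sub_eq {Λ Λ' : ℝ → ℝ} {e' β₀ : ℝ} (hanti : StrictAntiOn Λ (Ioc 0 e')) (honto : ∀ y : ℝ, Λ e' ≤ y → ∃ x ∈ Ioc (0 : ℝ) e', Λ x = y) (hβ₀ : 0 ≤ β₀)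
    (hsub : ∀ x ∈ Ioc (0 : ℝ) e', Λ' x - Λ x = Λ' e' - Λ e') {g s : ℝ} (hg : g ∈ Ioc (0 : ℝ) e') (hs : 0 ≤ s) :
    invFunOn Λ' (Ioc 0 e') (Λ' g + s * β₀) = invFunOn Λ (Ioc 0 e') (Λ g + s * β₀) := by
  obtain ⟨m₁, e₁⟩ := rg_mem_eq hanti honto hβ₀ hg hs
  -- Λ′ is strictly antitone too, and the Λ-preimage is a Λ′-preimage
  have hanti' : StrictAntiOn Λ' (Ioc 0 e') := by
    intro a ha b hb hab
    have h1 := hanti ha hb hab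
    have h2 := hsub a ha
    have h3 := hsub b hb
    linarith
  have hex : ∃ x ∈ Ioc (0 : ℝ) e', Λ' x = Λ' g + s * β₀ := by
    refine ⟨invFunOn Λ (Ioc 0 e') (Λ g + s * β₀), m₁, ?_⟩
    have h2 := hsub _ m₁
    have h3 := hsub g hg
    linarith
  have m₂ := invFunOn_mem hex
  have e₂ := invFunOn_eq hex
  refine (hanti'.eq_iff_eq m₂ m₁).mp ?_ |>.symm
  rw [e₂]
  have h2 := hsub _ m₁
  have h3 := hsub g hg
  linarith

/-- **ALL DYNAMICAL ABEL FUNCTIONS GENERATE THE SAME SEMIGROUP.**  `B` with memory profile on ]0, γ]^ℕ; ONE AF reference; part 14's package at e′ (with `64C_m e′³ ≤ (1−θ)²` and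
the separation clause); Λ, Λ′ two dynamical Abel functions (comparison sequences a, a′ — e.g. two reference pins, or the relative Λ and the two-loop Λ₂), Λ strictly
antitone and onto `[Λ e′, ∞[`.  THEN `invFunOn Λ′ (Ioc 0 e′) (Λ′ g + sβ₀) = invFunOn Λ (Ioc 0 e′) (Λ g + sβ₀)` for all `g ∈ ]0, e′]`, `s ≥ 0`: THE continuous
renormalization group does not depend on the reference pin nor on the loop order of the coordinate. [folklore] -/
theorem rg_eq_of_dynAbel {B : (ℕ → ℝ) → ℝ} {Cm θ γ β₀ bs ta gs e' : ℝ} {t : ℕ → ℝ} {a a' : ℕ → ℝ} {Λ Λ' : ℝ → ℝ}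
    (hB : MemoryProfile Cm θ γ B) (hCm : 0 ≤ Cm) (hθ0 : 0 ≤ θ) (hθ1 : θ < 1) (hbs : 0 < bs) (hta : 0 < ta)
    (hts : SeqBox γ t) (htf : MemFlow B gs t) (hprof : ∀ m : ℕ, 1 / ta ^ 2 + bs * (m : ℝ) ≤ 1 / (t m) ^ 2)
    (hΛ : ∀ e ∈ Ioc (0 : ℝ) e', ∀ h : ℕ → ℝ, SeqBox γ h → MemFlow B e h → Tendsto (fun n => 1 / h n ^ 2 - a n) atTop (𝓝 (Λ e)))
    (hΛ' : ∀ e ∈ Ioc (0 : ℝ) e', ∀ h : ℕ → ℝ, SeqBox γ h → MemFlow B e h → Tendsto (fun n => 1 / h n ^ 2 - a' n) atTop (𝓝 (Λ' e)))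
    (hanti : StrictAntiOn Λ (Ioc 0 e')) (honto : ∀ y : ℝ, Λ e' ≤ y → ∃ x ∈ Ioc (0 : ℝ) e', Λ x = y) (hβ₀ : 0 ≤ β₀)
    (he' : 0 < e') (h2e' : 2 * e' ≤ γ)
    (hs1 : 4 * Cm * e' ≤ bs * (1 - θ))
    (hs2 : e' ^ 2 * (1 / gs ^ 2 + Cm * γ / (1 - θ) ^ 2 + (2 * Cm / ((1 - θ) * bs)) ^ 2) ≤ 3 / 4)
    (hs4 : 64 * Cm * e' ^ 3 ≤ (1 - θ) ^ 2) (hs5 : Cm * (8 * e' ^ 3 + 16 * e' / bs) ≤ (1 - θ) / 4)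
    {g s : ℝ} (hg : g ∈ Ioc (0 : ℝ) e') (hs : 0 ≤ s) :
    invFunOn Λ' (Ioc 0 e') (Λ' g + s * β₀) = invFunOn Λ (Ioc 0 e') (Λ g + s * β₀) := by
  refine rg_eq_of_sub_eq hanti honto hβ₀ (fun x hx => ?_) hg hs
  have h := dynAbel_sub_dynAbel hB hCm hθ0 hθ1 hbs hta hts htf hprof hΛ' hΛ he' h2e' hs1 hs2 hs4 hs5 hx
  linarith

/-- **EVERY LÉVY-ISOMETRIC ABEL FUNCTION GENERATES THE CANONICAL SEMIGROUP.**  Under the data of part 45's `abel_levy_eq_dynAbel` (Λ a dynamical Abel function, strictly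
antitone onto `[Λ e′, ∞[`; Φ ANY Abel function of the trajectories on ]0, e′] with Lévy's criterion): `invFunOn Φ (Ioc 0 e′) (Φ g + sβ₀) = invFunOn Λ (Ioc 0 e′) (Λ g + sβ₀)`
for all `g ∈ ]0, e′]`, `s ≥ 0` — the continuous renormalization group, its half-step, every fractional step are DETERMINED by the trajectories together with first-order
agreement with the chart `1∕g²`.  (Without Lévy's criterion this fails: part 48.) [folklore; Szekeres' principal iteration group, proved here] -/
theorem rg_eq_of_levy {B : (ℕ → ℝ) → ℝ} {Cm θ γ β₀ bs ta gs e' : ℝ} {t h' : ℕ → ℝ} {a : ℕ → ℝ} {Λ Φ : ℝ → ℝ}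
    (hB : MemoryProfile Cm θ γ B) (hCm : 0 ≤ Cm) (hθ0 : 0 ≤ θ) (hθ1 : θ < 1) (hbs : 0 < bs) (hta : 0 < ta)
    (h0 : ∀ u : ℕ → ℝ, SeqBox γ u → |B u - β₀| ≤ Cm * ∑' j, θ ^ j * u j)
    (hts : SeqBox γ t) (htf : MemFlow B gs t) (hprof : ∀ m : ℕ, 1 / ta ^ 2 + bs * (m : ℝ) ≤ 1 / (t m) ^ 2)
    (hΛ : ∀ e ∈ Ioc (0 : ℝ) e', ∀ h : ℕ → ℝ, SeqBox γ h → MemFlow B e h → Tendsto (fun n => 1 / h n ^ 2 - a n) atTop (𝓝 (Λ e)))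
    (hanti : StrictAntiOn Λ (Ioc 0 e')) (honto : ∀ y : ℝ, Λ e' ≤ y → ∃ x ∈ Ioc (0 : ℝ) e', Λ x = y)
    (he' : 0 < e') (h2e' : 2 * e' ≤ γ)
    (hs1 : 4 * Cm * e' ≤ bs * (1 - θ))
    (hs2 : e' ^ 2 * (1 / gs ^ 2 + Cm * γ / (1 - θ) ^ 2 + (2 * Cm / ((1 - θ) * bs)) ^ 2) ≤ 3 / 4)
    (hs4 : 64 * Cm * e' ^ 3 ≤ (1 - θ) ^ 2) (hs5 : Cm * (8 * e' ^ 3 + 16 * e' / bs) ≤ (1 - θ) / 4)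
    (hhs' : SeqBox γ h') (hhf' : MemFlow B e' h')
    (hΦ : ∀ e ∈ Ioc (0 : ℝ) e', ∀ h : ℕ → ℝ, SeqBox γ h → MemFlow B e h → ∀ k : ℕ, Φ (h k) = Φ e + (k : ℝ) * β₀)
    (hL : ∀ W ε : ℝ, 0 < ε → ∃ δ > 0, ∀ g g' : ℝ, 0 < g → g ≤ g' → g' ≤ δ → g' ≤ e' → 1 / g ^ 2 - 1 / g' ^ 2 ≤ W →
      |(Φ g - Φ g') - (1 / g ^ 2 - 1 / g' ^ 2)| ≤ ε)
    {g s : ℝ} (hg : g ∈ Ioc (0 : ℝ) e') (hs : 0 ≤ s) :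
    invFunOn Φ (Ioc 0 e') (Φ g + s * β₀) = invFunOn Λ (Ioc 0 e') (Λ g + s * β₀) := by
  have hβ₀ : 0 < β₀ :=
    EriceFlowEnclosureB12AsPrintedHistoryContagionShiftFlowZero.valueAtZero_pos hCm hθ0 hθ1 hbs hta h0 hts htf hprof
  refine rg_eq_of_sub_eq hanti honto hβ₀.le (fun x hx => ?_) hg hs
  have h := abel_levy_eq_dynAbel hB hCm hθ0 hθ1 hbs hta h0 hts htf hprof hΛ he' h2e' hs1 hs2 hs4 hs5 hhs' hhf' hΦ hL hx.1 hx.2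
  linarith

/-- **EQUIVARIANCE: THE SEMIGROUP PERMUTES THE TRAJECTORIES.**  Under the data of part 46 (Λ a dynamical Abel function, strictly antitone onto `[Λ e′, ∞[`, the value β₀ of
B at zero, part 14's package at e′): for every box solution h from a pin `e ∈ ]0, e′]`, every `s ≥ 0` and every k, **`solution B (φ_s e) k = φ_s (h k)`**,
`φ_s = invFunOn Λ (Ioc 0 e′) (Λ · + sβ₀)` — the trajectory from the time-s image of the pin IS the time-s image of the trajectory; in particular `φ_s` commutes with
the renormalization step. [folklore] -/
theorem rg_solution_eq {B : (ℕ → ℝ) → ℝ} {Cm θ γ β₀ bs ta gs e' e : ℝ} {t h : ℕ → ℝ} {a : ℕ → ℝ} {Λ : ℝ → ℝ}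
    (hB : MemoryProfile Cm θ γ B) (hCm : 0 ≤ Cm) (hθ0 : 0 ≤ θ) (hθ1 : θ < 1) (hbs : 0 < bs) (hta : 0 < ta)
    (h0 : ∀ u : ℕ → ℝ, SeqBox γ u → |B u - β₀| ≤ Cm * ∑' j, θ ^ j * u j)
    (hts : SeqBox γ t) (htf : MemFlow B gs t) (hprof : ∀ m : ℕ, 1 / ta ^ 2 + bs * (m : ℝ) ≤ 1 / (t m) ^ 2)
    (hΛ : ∀ e ∈ Ioc (0 : ℝ) e', ∀ h : ℕ → ℝ, SeqBox γ h → MemFlow B e h → Tendsto (fun n => 1 / h n ^ 2 - a n) atTop (𝓝 (Λ e)))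
    (hanti : StrictAntiOn Λ (Ioc 0 e')) (honto : ∀ y : ℝ, Λ e' ≤ y → ∃ x ∈ Ioc (0 : ℝ) e', Λ x = y)
    (h2e' : 2 * e' ≤ γ)
    (hs1 : 4 * Cm * e' ≤ bs * (1 - θ))
    (hs2 : e' ^ 2 * (1 / gs ^ 2 + Cm * γ / (1 - θ) ^ 2 + (2 * Cm / ((1 - θ) * bs)) ^ 2) ≤ 3 / 4)
    (hs4 : 64 * Cm * e' ^ 3 ≤ (1 - θ) ^ 2) (hs5 : Cm * (8 * e' ^ 3 + 16 * e' / bs) ≤ (1 - θ) / 4)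
    (he : e ∈ Ioc (0 : ℝ) e') (hhs : SeqBox γ h) (hhf : MemFlow B e h) {s : ℝ} (hs : 0 ≤ s) (k : ℕ) :
    solution B (invFunOn Λ (Ioc 0 e') (Λ e + s * β₀)) k = invFunOn Λ (Ioc 0 e') (Λ (h k) + s * β₀) := by
  have hγ : 0 ≤ γ := by linarith [he.1, he.2]
  have hβ₀ : 0 < β₀ :=
    EriceFlowEnclosureB12AsPrintedHistoryContagionShiftFlowZero.valueAtZero_pos hCm hθ0 hθ1 hbs hta h0 hts htf hprof
  -- the Abel relation along box solutions from pins of ]0, e′], and their membership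
  have habel : ∀ p ∈ Ioc (0 : ℝ) e', ∀ h : ℕ → ℝ, SeqBox γ h → MemFlow B p h →
      (∀ k : ℕ, h k ∈ Ioc (0 : ℝ) e') ∧ ∀ k : ℕ, Λ (h k) = Λ p + (k : ℝ) * β₀ := by
    intro p hp h hhs hhf
    obtain ⟨p1, p2, -, -⟩ := package_of_le hCm hθ1 hbs hγ hp.1 hp.2 hs1 hs2 hs4 hs5
    refine ⟨fun k => ⟨(hhs k).1, (succ_le_of_reference_flow hB hCm hθ0 hθ1 hbs hta h0 hts htf hprof hhs hhf p1 p2 k).2.2.trans hp.2⟩, fun k => ?_⟩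
    exact dynAbel_shift hB hCm hθ0 hθ1 hbs hta h0 hts htf hprof hΛ hp hhs hhf p1 p2 k
  -- the time-s image p of the pin e, and THE solution from it
  obtain ⟨mp, ep⟩ := rg_mem_eq hanti honto hβ₀.le he hs
  set p : ℝ := invFunOn Λ (Ioc 0 e') (Λ e + s * β₀) with hp
  obtain ⟨q1, q2, q4, -⟩ := package_of_le hCm hθ1 hbs hγ mp.1 mp.2 hs1 hs2 hs4 hs5
  obtain ⟨hps, hpf, -, -⟩ := memFlow_solution_of_reference hB hCm hθ0 hθ1 hbs hta hts htf hprof mp.1 (by linarith [mp.2]) q1 q2 q4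
  obtain ⟨hpmem, hpabel⟩ := habel p mp _ hps hpf
  obtain ⟨hhmem, hhabel⟩ := habel e he h hhs hhf
  -- both sides lie in ]0, e′] with Λ-value `Λ e + (s + k)β₀`
  obtain ⟨m₂, e₂⟩ := rg_mem_eq hanti honto hβ₀.le (hhmem k) hs
  refine (hanti.eq_iff_eq (hpmem k) m₂).mp ?_ |>.symm
  rw [hpabel k, e₂, hhabel k, ep]; ring

/-- **THE CONTINUOUS RG TRANSLATES THE CHART BY `sβ₀` UP TO A RELATIVE ERROR O(g).**  Under the data of part 44's isometry (Λ a dynamical Abel function, strictly antitone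
onto `[Λ e′, ∞[`, β₀ ≥ 0): for `g ∈ ]0, e′]` and `s ≥ 0`, **`|(1∕φ_s(g)² − 1∕g²) − sβ₀| ≤ κ·g·(1∕φ_s(g)² − 1∕g²)`**, `κ = 64C_m∕(3(1−θ)β*)` — the integrated continuous
β-function in the chart is `β₀` per unit scale with relative error `κg`; the continuous counterpart of part 33's `|β_eff(g) − β₀| ≤ 2C_m g∕(1−θ)`. [folklore] -/
theorem abs_rg_chart_sub_le {B : (ℕ → ℝ) → ℝ} {Cm θ γ β₀ bs ta gs e' : ℝ} {t : ℕ → ℝ} {a : ℕ → ℝ} {Λ : ℝ → ℝ}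
    (hB : MemoryProfile Cm θ γ B) (hCm : 0 ≤ Cm) (hθ0 : 0 ≤ θ) (hθ1 : θ < 1) (hbs : 0 < bs) (hta : 0 < ta)
    (hts : SeqBox γ t) (htf : MemFlow B gs t) (hprof : ∀ m : ℕ, 1 / ta ^ 2 + bs * (m : ℝ) ≤ 1 / (t m) ^ 2)
    (hΛ : ∀ e ∈ Ioc (0 : ℝ) e', ∀ h : ℕ → ℝ, SeqBox γ h → MemFlow B e h → Tendsto (fun n => 1 / h n ^ 2 - a n) atTop (𝓝 (Λ e)))
    (hanti : StrictAntiOn Λ (Ioc 0 e')) (honto : ∀ y : ℝ, Λ e' ≤ y → ∃ x ∈ Ioc (0 : ℝ) e', Λ x = y) (hβ₀ : 0 ≤ β₀)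
    (h2e' : 2 * e' ≤ γ)
    (hs1 : 4 * Cm * e' ≤ bs * (1 - θ))
    (hs2 : e' ^ 2 * (1 / gs ^ 2 + Cm * γ / (1 - θ) ^ 2 + (2 * Cm / ((1 - θ) * bs)) ^ 2) ≤ 3 / 4)
    (hs4 : 64 * Cm * e' ^ 3 ≤ (1 - θ) ^ 2) (hs5 : Cm * (8 * e' ^ 3 + 16 * e' / bs) ≤ (1 - θ) / 4)
    {g s : ℝ} (hg : g ∈ Ioc (0 : ℝ) e') (hs : 0 ≤ s) :
    |(1 / invFunOn Λ (Ioc 0 e') (Λ g + s * β₀) ^ 2 - 1 / g ^ 2) - s * β₀|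
      ≤ 64 * Cm / (3 * (1 - θ) * bs) * g * (1 / invFunOn Λ (Ioc 0 e') (Λ g + s * β₀) ^ 2 - 1 / g ^ 2) := by
  obtain ⟨m₁, e₁⟩ := rg_mem_eq hanti honto hβ₀ hg hs
  have hle : invFunOn Λ (Ioc 0 e') (Λ g + s * β₀) ≤ g :=
    EriceFlowEnclosureB12AsPrintedHistoryContagionShiftFlowZeroSemigroup.rg_le_self hanti honto hβ₀ hg hs
  have hiso := abs_dynAbel_sub_sub_chart_le hB hCm hθ0 hθ1 hbs hta hts htf hprof hΛ h2e' hs1 hs2 hs4 hs5 m₁.1 hle hg.2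
  rw [e₁] at hiso
  calc |(1 / invFunOn Λ (Ioc 0 e') (Λ g + s * β₀) ^ 2 - 1 / g ^ 2) - s * β₀|
      = |(Λ g + s * β₀ - Λ g) - (1 / invFunOn Λ (Ioc 0 e') (Λ g + s * β₀) ^ 2 - 1 / g ^ 2)| := by rw [abs_sub_comm]; ring_nf
    _ ≤ _ := hiso

/-- The solved form: for `κg < 1`, **`sβ₀∕(1 + κg) ≤ 1∕φ_s(g)² − 1∕g² ≤ sβ₀∕(1 − κg)`** — between g and its time-s image the chart is climbed by `sβ₀(1 + O(g))`.
[folklore] -/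
theorem rg_chart_twoSided {B : (ℕ → ℝ) → ℝ} {Cm θ γ β₀ bs ta gs e' : ℝ} {t : ℕ → ℝ} {a : ℕ → ℝ} {Λ : ℝ → ℝ}
    (hB : MemoryProfile Cm θ γ B) (hCm : 0 ≤ Cm) (hθ0 : 0 ≤ θ) (hθ1 : θ < 1) (hbs : 0 < bs) (hta : 0 < ta)
    (hts : SeqBox γ t) (htf : MemFlow B gs t) (hprof : ∀ m : ℕ, 1 / ta ^ 2 + bs * (m : ℝ) ≤ 1 / (t m) ^ 2)
    (hΛ : ∀ e ∈ Ioc (0 : ℝ) e', ∀ h : ℕ → ℝ, SeqBox γ h → MemFlow B e h → Tendsto (fun n => 1 / h n ^ 2 - a n) atTop (𝓝 (Λ e)))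
    (hanti : StrictAntiOn Λ (Ioc 0 e')) (honto : ∀ y : ℝ, Λ e' ≤ y → ∃ x ∈ Ioc (0 : ℝ) e', Λ x = y) (hβ₀ : 0 ≤ β₀)
    (h2e' : 2 * e' ≤ γ)
    (hs1 : 4 * Cm * e' ≤ bs * (1 - θ))
    (hs2 : e' ^ 2 * (1 / gs ^ 2 + Cm * γ / (1 - θ) ^ 2 + (2 * Cm / ((1 - θ) * bs)) ^ 2) ≤ 3 / 4)
    (hs4 : 64 * Cm * e' ^ 3 ≤ (1 - θ) ^ 2) (hs5 : Cm * (8 * e' ^ 3 + 16 * e' / bs) ≤ (1 - θ) / 4)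
    {g s : ℝ} (hg : g ∈ Ioc (0 : ℝ) e') (hs : 0 ≤ s) (hκg : 64 * Cm / (3 * (1 - θ) * bs) * g < 1) :
    s * β₀ / (1 + 64 * Cm / (3 * (1 - θ) * bs) * g) ≤ 1 / invFunOn Λ (Ioc 0 e') (Λ g + s * β₀) ^ 2 - 1 / g ^ 2 ∧
      1 / invFunOn Λ (Ioc 0 e') (Λ g + s * β₀) ^ 2 - 1 / g ^ 2 ≤ s * β₀ / (1 - 64 * Cm / (3 * (1 - θ) * bs) * g) := by
  have h1θ : 0 < 1 - θ := by linarith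
  have h := abs_rg_chart_sub_le hB hCm hθ0 hθ1 hbs hta hts htf hprof hΛ hanti honto hβ₀ h2e' hs1 hs2 hs4 hs5 hg hs
  set Δ : ℝ := 1 / invFunOn Λ (Ioc 0 e') (Λ g + s * β₀) ^ 2 - 1 / g ^ 2 with hΔ
  set κ : ℝ := 64 * Cm / (3 * (1 - θ) * bs) with hκ
  have hκ0 : 0 ≤ κ * g := mul_nonneg (by positivity) hg.1.le
  obtain ⟨hlo, hhi⟩ := abs_le.mp h
  have hpos1 : 0 < 1 + κ * g := by linarith
  have hpos2 : 0 < 1 - κ * g := by linarith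
  constructor
  · rw [div_le_iff₀ hpos1]; nlinarith
  · rw [le_div_iff₀ hpos2]; nlinarith

end

end Summit.QuantumFields.BalabanUV.Beta.EriceFlowEnclosureB12AsPrintedHistoryContagionShiftFlowZeroSemigroupCanonical
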